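import Summits.BirchSwinnertonDyer.BirchSwinnertonDyer.Theorems.ClassRecordThreeEulerHalvesAtThreeCartanCoverDocking
import HarnessLib

/-!
# Crux NUM `CartanOnePlaceDegreeLawAtThree` (item 24801), line `lattice`, stub (D3) `DescentNonsplitAtThree` — brick 2:
# the EISENSTEIN CONGRUENCE on the torus quotient `X.Gamma ∕ Γ̄(q)` (the obstruction to the descent is Eisenstein)

Seat `bsd-stepL-tam3-p1` g27 (LEAD of crux 24801; `--supports stmt-BirchSwinnertonDyer-24801 --as helper`). Setting: a Cartan datum
`X : CartanLevelCurveData D M C`, a Cartan place `q ∈ C` with a reduction datum `R : CoverReduction X q` (`red : O₀' ↠ M₂(𝔽_q)`, kernel `q O₀'`,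
`X.O = red⁻¹(𝔽_q[η])`), a weight-two form `F` on `Γ = X.Gamma`, and an additive subgroup `N ⊆ ℂ` containing every period of `F` on the principal
level-`q` group `Γ̄(q)` (in the application `N = 3Λ(W₁)`: «`u_C ∈ 3𝕃`»). Then the period class `P̄ : Γ → ℂ∕N` factors through
`red : Γ → 𝔽_q[η]^×`, a COMMUTATIVE group. THEOREM (`card_smul_period_sub_sum_mem`): for an index `n` prime to `q` with finite coset space
`Γ∖ι(O(n))`, representatives `α_i` and the permutation data `α_i γ = δ_i α_{e i}` (`δ_i ∈ Γ`, brick 1 `HeckePeriod.exists_perm_mul`),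
**`#(Γ∖ι(O(n))) · ∫^γ F − Σ_i ∫^{δ_i} F ∈ N`** — i.e. modulo `N` the Hecke correspondence acts on `P̄` through its DEGREE. PROOF: in the commutative
ring `K = 𝔽_q[η]` the relations read `red(α_i)·red(γ) = red(δ_i)·red(α_{e i})`; multiplying over `i` and cancelling the unit `∏ red(α_i)`
(`det red(α_i) = n ≢ 0 (mod q)`) gives `red(γ)^{#} = ∏ red(δ_i) = red(∏ δ_i)`, so `γ^{#}·(∏ δ_i)⁻¹ ∈ ker red = Γ̄(q)` has period in `N`, and the period map is
a homomorphism on `Γ`. With brick 1 (`a·∫^γ F = Σ_i ∫^{δ_i} F` for `T_n F = a F`) this yields `(a − #)·∫^γ F ∈ N`; brick 3 feeds `# = ℓ + 1` (print) and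
`a_ℓ(V) ≢ ℓ + 1 (mod 3)` for one good `ℓ` (tree `not_irreducible_of_frobeniusTrace_congr_off_finite`). This is the automorphic shadow of «the Shimura
covering `X̄(q) → X_C` has Eisenstein kernel» (Mazur, Eisenstein ideal §II.11; Ribet 1984) and replaces the Galois descent `E[3](ℚ(μ_q^∞)) = 0` of the
paper proof (NUM-PROOF-SKETCH rev 3, Prop. L1) by Hecke algebra over the tree's analytic vocabulary. Elementary; nothing about NUM, (D3) or any curve is
proved here; BSD is proved for no curve. [cite: ShimuraIATAF1971, §3.3 and §8.3 (8.3.2)] [cite: Mazur1977, §II.11 (the Shimura subgroup is Eisenstein)]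
-/

set_option linter.dupNamespace false
set_option autoImplicit false

noncomputable section

open scoped MatrixGroups ModularForm IsMulCommutative
open UpperHalfPlane

namespace Summit.BirchSwinnertonDyer.BirchSwinnertonDyer.Theorems.CartanCover

open Literature.NumberTheory.Automorphic

variable {D M : ℕ} {C : Finset ℕ} {X : CartanLevelCurveData D M C} {q : ℕ}

/-! ## §1 The commutative residue algebra `K = 𝔽_q[η]` and the reduction of `X.O` into it -/

namespace CoverReduction

/-- An element of `X.O` as an element of the cover subring `O₀'`. -/
def ofO (q : ℕ) (x : X.B) (hx : x ∈ X.O) : coverSubring X q := ⟨x, (mem_coverSubring_iff X q).mpr (le_coverOrder X q hx)⟩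

/-- `ofO` does not change the element. -/
@[simp] theorem coe_ofO (q : ℕ) (x : X.B) (hx : x ∈ X.O) : ((ofO q x hx : coverSubring X q) : X.B) = x := rfl

variable [Fact q.Prime] (R : CoverReduction X q)

/-- `K = 𝔽_q[η] ⊆ M₂(𝔽_q)`, the (commutative) subalgebra generated by `η`. -/
abbrev resAlg : Subalgebra (ZMod q) (Matrix (Fin 2) (Fin 2) (ZMod q)) := Algebra.adjoin (ZMod q) {R.η}

/-- `red x ∈ 𝔽_q[η]` for `x ∈ X.O` (the pinning `X.O = red⁻¹(𝔽_q[η])`, forward). -/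
theorem red_ofO_mem (x : X.B) (hx : x ∈ X.O) : R.red (ofO q x hx) ∈ R.resAlg := by
  obtain ⟨a, b, hab⟩ := (R.mem_O_iff (ofO q x hx)).mp hx
  rw [hab]
  exact Subalgebra.add_mem _ (Subalgebra.smul_mem _ (Subalgebra.one_mem _) a)
    (Subalgebra.smul_mem _ (Algebra.self_mem_adjoin_singleton (ZMod q) R.η) b)

/-- **`redK : X.O → K`**, the reduction with values in the commutative algebra `K = 𝔽_q[η]`. -/
def redK (x : X.B) (hx : x ∈ X.O) : R.resAlg := ⟨R.red (ofO q x hx), R.red_ofO_mem x hx⟩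

/-- `redK x` as a matrix is `red x`. -/
@[simp] theorem coe_redK (x : X.B) (hx : x ∈ X.O) : (R.redK x hx : Matrix (Fin 2) (Fin 2) (ZMod q)) = R.red (ofO q x hx) := rfl

/-- `redK` is multiplicative on `X.O`. -/
theorem redK_mul (x y : X.B) (hx : x ∈ X.O) (hy : y ∈ X.O) :
    R.redK (x * y) (X.isOrder.mul_mem x hx y hy) = R.redK x hx * R.redK y hy := by
  apply Subtype.ext
  change R.red (ofO q (x * y) _) = R.red (ofO q x hx) * R.red (ofO q y hy)
  rw [← map_mul]
  rfl

/-- An element of `K` with invertible determinant is a unit of `K` (`K` is finite and the multiplication by it is injective). [folklore] -/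
theorem isUnit_of_isUnit_det {m : R.resAlg} (hm : IsUnit (m : Matrix (Fin 2) (Fin 2) (ZMod q)).det) : IsUnit m := by
  have hmu : IsUnit (m : Matrix (Fin 2) (Fin 2) (ZMod q)) := (Matrix.isUnit_iff_isUnit_det _).mpr hm
  haveI : Finite R.resAlg := Finite.of_injective (fun k : R.resAlg => (k : Matrix (Fin 2) (Fin 2) (ZMod q))) Subtype.val_injective
  have hinj : Function.Injective (fun k : R.resAlg => m * k) := by
    intro k k' hkk'
    have h := congrArg (fun z : R.resAlg => (z : Matrix (Fin 2) (Fin 2) (ZMod q))) hkk'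
    simp only [Subalgebra.coe_mul] at h
    exact Subtype.ext (hmu.mul_right_injective h)
  obtain ⟨k, hk⟩ := (Finite.injective_iff_surjective.mp hinj) 1
  exact isUnit_iff_exists_inv.mpr ⟨k, hk⟩

/-- `red x` is a unit of `K` for `x ∈ X.O` of reduced norm `n` prime to `q`. -/
theorem isUnit_redK_of_norm (x : X.B) (hx : x ∈ X.O) {n : ℕ} (hn : ¬ q ∣ n) (hnorm : (X.ι x).det = n) : IsUnit (R.redK x hx) := by
  refine R.isUnit_of_isUnit_det ?_
  obtain ⟨m, hm, hdet⟩ := R.det_red (ofO q x hx)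
  have hmn : m = n := by
    have h := AlgHom.det_eq_reducedNorm X.ι x
    rw [hnorm, coe_ofO] at *
    rw [hm] at h
    have h' : ((n : ℚ) : ℝ) = ((m : ℚ) : ℝ) := by rw [Rat.cast_natCast]; exact h
    exact_mod_cast h'.symm
  rw [coe_redK, hdet, hmn, Int.cast_natCast]
  rw [isUnit_iff_ne_zero, Ne, ZMod.natCast_eq_zero_iff]
  exact hn

/-- `redHom γ` as a matrix is `redK` of any `y ∈ X.O` with `ι y = γ`. -/
theorem coe_redHom_eq_redK (γ : coverUnits X q) (y : X.B) (hy : y ∈ X.O) (hyγ : X.ι y = ((γ : GL (Fin 2) ℝ) : Matrix (Fin 2) (Fin 2) ℝ)) :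
    ((R.redHom γ : GL (Fin 2) (ZMod q)) : Matrix (Fin 2) (Fin 2) (ZMod q)) = (R.redK y hy : Matrix (Fin 2) (Fin 2) (ZMod q)) := by
  rw [CartanCover.CoverReduction.coe_redHom, unitLift_eq_of_ι_eq γ (le_coverOrder X q hy) hyγ]
  rfl

end CoverReduction

namespace Eisenstein

/-! ## §2 The period class on `X.Gamma` modulo `N` is a homomorphism killing `Γ̄(q)` -/

section PeriodClass

variable (X)

/-- Additivity, inverses and powers of the period `γ ↦ ∫_z^{γz} F` on `X.Gamma` (Shimura (8.2.20)), from a hypothesis `hinv` of `Γ`-invariance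
of segment integrals (supplied by the caller from the tree's slash transport; kept as a hypothesis so that this brick imports only the reduction datum). -/
theorem period_list_prod (F : CuspForm X.Gamma 2)
    (hinv : ∀ {δ : GL (Fin 2) ℝ}, δ ∈ X.Gamma → ∀ z w : ℍ, segmentIntegral F (δ • z) (δ • w) = segmentIntegral F z w) (z : ℍ) :
    ∀ l : List (GL (Fin 2) ℝ), (∀ g ∈ l, g ∈ X.Gamma) →
      segmentIntegral F z (l.prod • z) = (l.map fun g => segmentIntegral F z (g • z)).sum := by
  -- additivity `∫_z^{γδz} = ∫_z^{γz} + ∫_z^{δz}` for `γ ∈ Γ`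
  have hmul : ∀ {γ : GL (Fin 2) ℝ}, γ ∈ X.Gamma → ∀ δ : GL (Fin 2) ℝ,
      segmentIntegral F z ((γ * δ) • z) = segmentIntegral F z (γ • z) + segmentIntegral F z (δ • z) := by
    intro γ hγ δ
    rw [mul_smul]
    have eC := segmentIntegral_sub_segmentIntegral F z (γ • z) (γ • δ • z)
    have eB := hinv hγ z (δ • z)
    linear_combination eC + eB
  intro l hl
  induction l with
  | nil =>
    simp only [List.prod_nil, one_smul, List.map_nil, List.sum_nil]
    have e := segmentIntegral_sub_segmentIntegral F z z z
    rw [sub_self] at e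
    exact e.symm
  | cons g l ih =>
    rw [List.prod_cons, List.map_cons, List.sum_cons, hmul (hl g (by simp)), ih (fun g' hg' => hl g' (by simp [hg']))]

end PeriodClass

/-! ## §3 The Eisenstein congruence -/

/-- **THE EISENSTEIN CONGRUENCE.** Let the prime `q` carry a reduction datum `R` of the cover order (available for `q ∈ C`, tree `coverReductionExists`), let `n` be prime to `q` with `Γ∖ι(O(n))` finite, let `F ∈ S₂(X.Gamma)` have
all its `Γ̄(q)`-periods in the additive subgroup `N`, and let `α_i γ = δ_i α_{e i}` (`γ, δ_i ∈ Γ`, `e` a permutation of the coset space, `α_i` the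
representatives). Then `#(Γ∖ι(O(n))) · ∫_z^{γz} F − Σ_i ∫_z^{δ_i z} F ∈ N`.
[cite: Mazur1977, §II.11] [cite: ShimuraIATAF1971, §3.3] -/
theorem card_smul_period_sub_sum_mem [Fact q.Prime] (R : CoverReduction X q) (n : ℕ) (hn : ¬ q ∣ n)
    [Fintype (Quotient (X.heckeSetoid n))] (F : CuspForm X.Gamma 2)
    (N : AddSubgroup ℂ) (hN : ∀ g ∈ principalLevel X q, ∀ z : ℍ, segmentIntegral F z (g • z) ∈ N)
    {γ : GL (Fin 2) ℝ} (hγ : γ ∈ X.Gamma)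
    (e : Quotient (X.heckeSetoid n) ≃ Quotient (X.heckeSetoid n)) (δ : Quotient (X.heckeSetoid n) → GL (Fin 2) ℝ)
    (hδ : ∀ i, δ i ∈ X.Gamma)
    (hδeq : ∀ i, ((i.out : X.heckeSet n) : GL (Fin 2) ℝ) * γ = δ i * (((e i).out : X.heckeSet n) : GL (Fin 2) ℝ)) (z : ℍ) :
    (Fintype.card (Quotient (X.heckeSetoid n)) : ℂ) * segmentIntegral F z (γ • z)
      - ∑ i, segmentIntegral F z (δ i • z) ∈ N := by
  classical
  -- §0. `Γ`-invariance of segment integrals (tree slash transport `CartanDegree.segmentIntegral_slash_inv_smul` with `F ∣[2] δ = F`)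
  have hinv : ∀ {δ' : GL (Fin 2) ℝ}, δ' ∈ X.Gamma → ∀ z' w' : ℍ, segmentIntegral F (δ' • z') (δ' • w') = segmentIntegral F z' w' := by
    intro δ' hδ' z' w'
    have hdet : 0 < δ'.det.val := by rw [Subgroup.HasDetOne.det_eq hδ', Units.val_one]; exact one_pos
    have h := CartanDegree.segmentIntegral_slash_inv_smul F hdet (δ' • z') w'
    rw [inv_smul_smul, SlashInvariantForm.slash_action_eqn F δ' hδ'] at h
    exact h.symm
  -- §a. lifts to `B`: `ι x_i = α_i` (`x_i ∈ O`, norm `n`), `ι y = γ`, `ι d_i = δ_i`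
  have hx : ∀ i : Quotient (X.heckeSetoid n), ∃ x ∈ X.O, X.ι x = (((i.out : X.heckeSet n) : GL (Fin 2) ℝ) : Matrix (Fin 2) (Fin 2) ℝ) :=
    fun i => (i.out : X.heckeSet n).2.1
  choose x hxO hxι using hx
  have hxdet : ∀ i, (X.ι (x i)).det = n := fun i => by rw [hxι]; exact (i.out : X.heckeSet n).2.2
  obtain ⟨y, hyO, hyι⟩ := hγ.1
  have hd : ∀ i, ∃ d ∈ X.O, X.ι d = ((δ i : GL (Fin 2) ℝ) : Matrix (Fin 2) (Fin 2) ℝ) := fun i => (hδ i).1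
  choose d hdO hdι using hd
  -- §b. the relations in `B`: `x_i y = d_i x_{e i}`
  have hrel : ∀ i, x i * y = d i * x (e i) := by
    intro i
    apply X.ι_injective
    rw [map_mul, map_mul, hxι, hyι, hdι, hxι, ← Units.val_mul, ← Units.val_mul, hδeq i]
  -- §c. in the commutative algebra `K = 𝔽_q[η]`: `X_i * Y = D_i * X_{e i}`, hence `Y ^ # = ∏ D_i`
  set Y : R.resAlg := R.redK y hyO with hYdef
  set Xr : Quotient (X.heckeSetoid n) → R.resAlg := fun i => R.redK (x i) (hxO i) with hXdef
  set Dr : Quotient (X.heckeSetoid n) → R.resAlg := fun i => R.redK (d i) (hdO i) with hDdef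
  have hrelK : ∀ i, Xr i * Y = Dr i * Xr (e i) := by
    intro i
    rw [hXdef, hYdef, hDdef]
    simp only
    rw [← R.redK_mul, ← R.redK_mul]
    simp only [hrel i]
  have hprod : (∏ i, Xr i) * Y ^ Fintype.card (Quotient (X.heckeSetoid n)) = (∏ i, Dr i) * ∏ i, Xr i := by
    rw [← Finset.card_univ, ← Finset.prod_const, ← Finset.prod_mul_distrib]
    simp_rw [hrelK]
    rw [Finset.prod_mul_distrib, Equiv.prod_comp e Xr]
  have hXunit : IsUnit (∏ i, Xr i) :=
    IsUnit.prod_iff.mpr fun i _ => R.isUnit_redK_of_norm (x i) (hxO i) hn (hxdet i)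
  have hpow : Y ^ Fintype.card (Quotient (X.heckeSetoid n)) = ∏ i, Dr i := by
    have h := hprod
    rw [mul_comm (∏ i, Dr i)] at h
    exact hXunit.mul_left_cancel h
  -- §d. back to `GL₂(𝔽_q)`: `redHom (γ ^ # · (∏ δ_i)⁻¹) = 1`, so that element lies in `Γ̄(q)`
  set L : List (Quotient (X.heckeSetoid n)) := Finset.univ.toList with hLdef
  set γU : coverUnits X q := ⟨γ, Gamma_le_coverUnits X q hγ⟩ with hγU
  set δU : Quotient (X.heckeSetoid n) → coverUnits X q := fun i => ⟨δ i, Gamma_le_coverUnits X q (hδ i)⟩ with hδU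
  have hmatY : ((R.redHom γU : GL (Fin 2) (ZMod q)) : Matrix (Fin 2) (Fin 2) (ZMod q)) = (Y : Matrix (Fin 2) (Fin 2) (ZMod q)) :=
    R.coe_redHom_eq_redK γU y hyO hyι
  have hmatD : ∀ i, ((R.redHom (δU i) : GL (Fin 2) (ZMod q)) : Matrix (Fin 2) (Fin 2) (ZMod q)) = (Dr i : Matrix (Fin 2) (Fin 2) (ZMod q)) :=
    fun i => R.coe_redHom_eq_redK (δU i) (d i) (hdO i) (hdι i)
  have hker : R.redHom (γU ^ Fintype.card (Quotient (X.heckeSetoid n)) * ((L.map δU).prod)⁻¹) = 1 := by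
    rw [map_mul, map_inv, mul_inv_eq_one, map_pow, map_list_prod]
    apply Units.ext
    rw [Units.val_pow_eq_pow_val, hmatY, ← Units.coeHom_apply, map_list_prod]
    have hL : ((L.map δU).map ⇑R.redHom).map ⇑(Units.coeHom (Matrix (Fin 2) (Fin 2) (ZMod q))) = (L.map Dr).map R.resAlg.val := by
      simp only [List.map_map]
      refine List.map_congr_left fun i _ => ?_
      simp only [Function.comp_apply, Units.coeHom_apply, hmatD, Subalgebra.coe_val]
    rw [hL, ← map_list_prod, hLdef, Finset.prod_map_toList, ← hpow]
    simp
  have hmem : ((γU ^ Fintype.card (Quotient (X.heckeSetoid n)) * ((L.map δU).prod)⁻¹ : coverUnits X q) : GL (Fin 2) ℝ) ∈ principalLevel X q :=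
    (R.mem_ker_redHom_iff _).mp hker
  -- §e. periods: the period of that element lies in `N`, and it equals `# · ∫^γ − Σ_i ∫^{δ_i}`
  have hP := hN _ hmem z
  -- rewrite the element of `GL₂(ℝ)` as a list product of elements of `Γ`
  have hcoe : ((γU ^ Fintype.card (Quotient (X.heckeSetoid n)) * ((L.map δU).prod)⁻¹ : coverUnits X q) : GL (Fin 2) ℝ) =
      ((List.replicate (Fintype.card (Quotient (X.heckeSetoid n))) γ) ++ (L.map fun i => (δ i)⁻¹).reverse).prod := by
    rw [Subgroup.coe_mul, Subgroup.coe_pow, Subgroup.coe_inv, Subgroup.val_list_prod, List.map_map, List.prod_append, List.prod_replicate,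
      List.prod_inv_reverse, List.map_map]
    rfl
  rw [hcoe, period_list_prod X F hinv z] at hP
  · -- evaluate the sum
    rw [List.map_append, List.sum_append, List.map_replicate, List.sum_replicate, List.map_reverse, List.sum_reverse, List.map_map] at hP
    have hinvP : ∀ i, segmentIntegral F z ((δ i)⁻¹ • z) = -segmentIntegral F z (δ i • z) := by
      intro i
      have h1 := hinv (hδ i) ((δ i)⁻¹ • z) z
      rw [smul_inv_smul] at h1
      have h2 := segmentIntegral_sub_segmentIntegral F z ((δ i)⁻¹ • z) z
      have e0 := segmentIntegral_sub_segmentIntegral F z z z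
      rw [sub_self] at e0
      linear_combination h1 - h2 - e0
    have hsum : (L.map ((fun g => segmentIntegral F z (g • z)) ∘ fun i => (δ i)⁻¹)).sum = -∑ i, segmentIntegral F z (δ i • z) := by
      rw [hLdef]
      have : ((fun g => segmentIntegral F z (g • z)) ∘ fun i => (δ i)⁻¹) = fun i => -segmentIntegral F z (δ i • z) := by
        funext i; exact hinvP i
      rw [this, Finset.sum_map_toList, Finset.sum_neg_distrib]
    rw [hsum, nsmul_eq_mul, ← sub_eq_add_neg] at hP
    exact hP
  · intro g hg
    rw [List.mem_append, List.mem_replicate, List.mem_reverse, List.mem_map] at hg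
    rcases hg with ⟨-, rfl⟩ | ⟨i, -, rfl⟩
    · exact hγ
    · exact inv_mem (hδ i)

end Eisenstein

end Summit.BirchSwinnertonDyer.BirchSwinnertonDyer.Theorems.CartanCover

end
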